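import Literature.AnabelianGeometry.EtaleTheta.BiKummerThm44SubModelConnectedOfGaloisCovering
import Literature.AnabelianGeometry.EtaleTheta.Discharge.Sec3BLambdaInjectiveOfGaloisCoveringConnected
import Literature.AnabelianGeometry.EtaleTheta.Discharge.Sec3BLambdaInjectiveOfRlfRReflects
import Literature.AnabelianGeometry.EtaleTheta.Discharge.Sec3Thm37UnitsOfDivisorialWeak
import Literature.AnabelianGeometry.EtaleTheta.Discharge.Sec3Thm37Units
import Literature.AnabelianGeometry.EtaleTheta.Discharge.Sec3Thm37UnitProfinite

/-!
# [EtTh] Def 3.6 (ii) / Thm 3.7 (i)(iv) over the CONSTRUCTED Def 3.3 (iii) data of the connected coverings at the genuine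
# base `B^temp(Π)⁰`, all three monoid types: «`B` a monoid on `D`», «`C` a Frobenioid», «`C` slim» with the Def 3.6 (i)
# binder `hBinj` DISCHARGED (proof-only sequel)

S. Mochizuki, *The étale theta function and its Frobenioid-theoretic manifestations*, Publ. RIMS **45** (2009)
[MochizukiEtTh2009], §3: Def 3.3 (iii) PDF p.73, Def 3.6 (i)(ii) PDF pp.76–77 (`B₀^ℝ := ℝ·Φ₀^birat`; «`B` … a group-like
monoid on `D`»; «the data `(D, Φ, B, B → Φ^gp)` determines a model Frobenioid `C`»), Thm 3.7 (i) PDF p.79 («if `Λ = ℤ`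
(resp. `Λ = ℝ`), then `C` is of unit-profinite (resp. unit-trivial) type»), Thm 3.7 (iv) PDF p.80 («if `D` is slim, then
so is `C`»); S. Mochizuki, *The geometry of Frobenioids I* (2008) [MochizukiFrdI2008], Def 1.1 (ii) p.19, Thm 5.2 (ii)
p.100.  abc-iut cell, layer L2; cone nodes `EtTh:Def3.6(ii)`, `EtTh:Thm3.7(i)`, `EtTh:Thm3.7(iv)`.  Seat abc-iut-w5-d179
(gen 5), SUBDAG-EtTh-Thm44 custodian lineage — sequel of `BiKummerThm44SubModelConnectedOfGaloisCovering.lean` (p439044: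
`hBinj` a THEOREM at `ofRlfZ[Weak]` / `ofRlfQ[Weak]` of abc-iut-w6-d058's `DivisorMonoids.ofGaloisActionConnected`) and of
abc-iut-w6-d048's `Sec3BLambdaInjectiveOfGaloisCoveringConnected.lean` (p439556: pull-back of log-divisors REFLECTS
divisibility there, `hBinj` a THEOREM at `ofRlfRWeak`, «`B` monoid on `D`» / «`C` Frobenioid» for `Λ = ℝ` weak).
PROOF-ONLY (0 `def`s, no `Prop` facts, no instances); everything landed is consumed BY NAME, nothing restated.

WHAT THIS FILE ADDS (all at the genuine base `D = B^temp(Π)⁰ = ConnectedPart (BTemp Π)`, any topological group `Π`;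
[FrdII] Ex 1.3 (i) supplies the FSM clause, [SemiAnbd] Rmk 3.4.1 / Ex 3.10 print's «`D` slim»):
* §1 `Λ = ℝ`, strong data: `DivisorMonoids.ofGaloisActionConnected_ofRlfR_hBinj` — `hBinj` a THEOREM at the SIXTH and
  last Def 3.6 (i) constructor `ofRlfR … hpf` (abc-iut-w6-d048's `ofRlfR_hBinj_of_reflects` with both `Φ₀`-clauses
  discharged by p437704 / p439556; printed perf-factorial slot `hpf` = the constructor's own parameter);
* §2 `Λ = ℝ`, weak data: **Thm 3.7 (iv)'s conclusion «`C` is slim» ⇐ {`Π` tempered, `Π` temp-slim} ONLY**, hence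
  **UNCONDITIONAL at print's `Π = Π^tp_X`** (`TemperedArithmeticGroup.isSlim_connectedPart`) — for EVERY tempered
  Frobenioid of monoid type `ℝ` over the constructed data of the connected coverings;
* §3 `Λ = ℤ`, weak data: «`B` a monoid on `D`» and «`C` a Frobenioid» UNCONDITIONAL (also over any base of FSM-type);
  **Thm 3.7 (i) «unit-profinite type» ∧ (iv) «`C` slim» ⇐ {`Π` tempered, temp-slim, the Prop 3.4 (ii) isomorphisms
  `hP34`} ONLY** — no `hBinj`, no `hBmon`, no Rmk 3.7.2;
* §4 the strong-data twins (`ofRlfR … hpf`, `ofRlfZ … hpf`).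
Binder census of `EtTh:Def3.6(ii)` at the constructed connected data: ∅ for every monoid type and both vocabularies (the
strong `hpf` being a constructor parameter, not a hypothesis of Def 3.6 (ii)).

HONEST FRAMING: refereed pre-IUT material; every theorem is an implication for data so parametrised
(`LogDivisorModel` / `GaloisAction` / `CuspLaws` are interface and parameter records — nothing asserts they arise from an
actual curve); one term of the Def 3.3 (iii) limit (Rmk 3.3.1); weak vocabulary = the reading of record (plan/FACT-LIST
F-L2d2-1: the printed perf-factorial reading fails for pieces with infinitely many Galois orbits of prime log-divisors);
nothing here bears on the disputed [IUTchIII] Cor. 3.12; typed ≠ proved — here PROVED.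
-/

noncomputable section

namespace Literature.AnabelianGeometry.EtaleTheta

open CategoryTheory Opposite Function Literature.AlgebraicGeometry.Frobenioids Literature.AnabelianGeometry.SemiGraphs

universe u v u' v' uK

/-! ### §1 `hBinj` at the strong `Λ = ℝ` constructor over the connected coverings: a THEOREM -/

namespace DivisorMonoids

open LogDivisorModel.GaloisAction

variable {Z : LogDivisorModel.{u}} {G : Type u} [Group G] (A : Z.GaloisAction G) (hZ : Z.CuspLaws)

/-- **`hBinj` is a THEOREM at the strong Def 3.6 (i) data `Λ = ℝ` over the connected coverings** (`B₀^ℝ = ℝ·Φ₀^birat ⊆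
(Φ₀^rlf)^gp`), for any value of the constructor's printed perf-factorial parameter `hpf`: abc-iut-w6-d048's
divisibility-reflection route `ofRlfR_hBinj_of_reflects` with `hΦinj := ofGaloisActionConnected_Φ₀_map_injective`
(p437704) and `hΦrefl := ofGaloisActionConnected_Φ₀_map_reflects_dvd` (p439556). [cite: MochizukiEtTh2009, Def 3.6 p.76] -/
theorem ofGaloisActionConnected_ofRlfR_hBinj
    (hpf : ∀ Y : ((isConnectedGSet (G := G)).FullSubcategory)ᵒᵖ, IsPerfFactorial ((ofGaloisActionConnected A hZ).Φ₀.obj Y)) :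
    ∀ {Y Y' : ((isConnectedGSet (G := G)).FullSubcategory)ᵒᵖ} (g : Y ⟶ Y'),
      Injective ((RealifiedDivisorMonoids.ofRlfR (ofGaloisActionConnected A hZ) hpf).BΛ.map g).hom :=
  RealifiedDivisorMonoids.ofRlfR_hBinj_of_reflects (ofGaloisActionConnected A hZ) hpf
    (fun g => ofGaloisActionConnected_Φ₀_map_injective A hZ g)
    (fun g a b h => ofGaloisActionConnected_Φ₀_map_reflects_dvd A hZ g a b h)

end DivisorMonoids

namespace TemperedFrobenioid

open LogDivisorModel.GaloisAction

/-! ### §2 `Λ = ℝ`, weak data: Thm 3.7 (iv) «`C` is slim» at the genuine base -/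

section WeakR

variable {Z : LogDivisorModel.{u}} {G : Type u} [Group G] (A : Z.GaloisAction G) (hZ : Z.CuspLaws)
  (hpf : ∀ Y : ((isConnectedGSet (G := G)).FullSubcategory)ᵒᵖ,
    IsPerfFactorialCof ((DivisorMonoids.ofGaloisActionConnected A hZ).Φ₀.obj Y))
  {P : Type v} [Group P] [TopologicalSpace P]
  {IsRational IsStrictlyRational : ((ConnectedPart (BTemp P))ᵒᵖ ⥤ CommMonCat.{u}) → Prop}
  (C₀ : TemperedFrobenioid (RealifiedDivisorMonoids.ofRlfRWeak (DivisorMonoids.ofGaloisActionConnected A hZ) hpf)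
    (ConnectedPart (BTemp P)) (treeCatVocab (ConnectedPart (BTemp P)) IsRational IsStrictlyRational))

/-- **[EtTh] Thm 3.7 (iv), conclusion «`C` is slim», for EVERY tempered Frobenioid of monoid type `ℝ` over the weak
constructed data of the connected coverings at the genuine base `B^temp(Π)⁰` ⇐ {`Π` tempered, `Π` temp-slim} ONLY**
(«`C` Frobenioid» := abc-iut-w6-d048's unconditional `isFrobenioid_ofRlfRWeak_ofGaloisActionConnected_connectedPart_bTemp`;
`hdiv` from unit-triviality via `ofRlfRWeak_divΛ_injective`; «`D` slim» := [SemiAnbd] Rmk 3.4.1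
`isSlim_connectedPart_bTemp`). [cite: MochizukiEtTh2009, Thm 3.7 p.80] -/
theorem isSlim_category_ofRlfRWeak_ofGaloisActionConnected_connectedPart_bTemp [IsTopologicalGroup P]
    (hG : IsTempered P) (hS : IsSlimGroup P) : IsSlim C₀.category :=
  C₀.isSlim_category_of_divΛ_injective
    (isFrobenioid_ofRlfRWeak_ofGaloisActionConnected_connectedPart_bTemp A hZ hpf C₀)
    (fun B => RealifiedDivisorMonoids.ofRlfRWeak_divΛ_injective _ _ (C₀.baseOp B)) (isSlim_connectedPart_bTemp hG hS)

/-- **[EtTh] Thm 3.7 (i) «unit-trivial type» ∧ Thm 3.7 (iv) «`C` slim» for monoid type `ℝ`** over the weak constructed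
data of the connected coverings at the genuine base ⇐ {`Π` tempered, `Π` temp-slim} only.
[cite: MochizukiEtTh2009, Thm 3.7 p.79] -/
theorem isUnitTrivial_and_isSlim_ofRlfRWeak_ofGaloisActionConnected_connectedPart_bTemp [IsTopologicalGroup P]
    (hG : IsTempered P) (hS : IsSlimGroup P) :
    PreFrobenioid.IsOfType (PreFrobenioid.IsUnitTrivial C₀.toElem) ∧ IsSlim C₀.category :=
  ⟨thm37_i_unitTrivial_ofRlfRWeak_treeCatVocab_holds _ hpf C₀,
    isSlim_category_ofRlfRWeak_ofGaloisActionConnected_connectedPart_bTemp A hZ hpf C₀ hG hS⟩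

end WeakR

section WeakRPrinted

variable {Z : LogDivisorModel.{u}} {G : Type u} [Group G] (A : Z.GaloisAction G) (hZ : Z.CuspLaws)
  (hpf : ∀ Y : ((isConnectedGSet (G := G)).FullSubcategory)ᵒᵖ,
    IsPerfFactorialCof ((DivisorMonoids.ofGaloisActionConnected A hZ).Φ₀.obj Y))
  {K : Type v} [Field K] (X : TemperedArithmeticGroup.{v} K)
  {IsRational IsStrictlyRational : ((ConnectedPart (BTemp X.Pi))ᵒᵖ ⥤ CommMonCat.{u}) → Prop}
  (C₀ : TemperedFrobenioid (RealifiedDivisorMonoids.ofRlfRWeak (DivisorMonoids.ofGaloisActionConnected A hZ) hpf)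
    (ConnectedPart (BTemp X.Pi)) (treeCatVocab (ConnectedPart (BTemp X.Pi)) IsRational IsStrictlyRational))

/-- **[EtTh] Thm 3.7 (iv) as printed, conclusion «`C` is slim», at `D = B^temp(Π^tp_X)⁰` for EVERY tempered Frobenioid
of monoid type `ℝ` over the weak constructed data of the connected coverings — UNCONDITIONAL** (`Π^tp_X` tempered and
temp-slim: [SemiAnbd] Ex 3.10, `TemperedArithmeticGroup.isSlim_connectedPart`; e.g. with
`hpf := DivisorMonoids.ofGaloisActionConnected_isPerfFactorialCof A hZ`, p439044). [cite: MochizukiEtTh2009, Thm 3.7 p.80] -/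
theorem isSlim_category_ofRlfRWeak_ofGaloisActionConnected_of_temperedArithmeticGroup : IsSlim C₀.category :=
  C₀.isSlim_category_of_divΛ_injective
    (isFrobenioid_ofRlfRWeak_ofGaloisActionConnected_connectedPart_bTemp A hZ hpf C₀)
    (fun B => RealifiedDivisorMonoids.ofRlfRWeak_divΛ_injective _ _ (C₀.baseOp B)) X.isSlim_connectedPart

end WeakRPrinted

/-! ### §3 `Λ = ℤ`, weak data: «`B` monoid on `D`», «`C` Frobenioid», Thm 3.7 (i) ∧ (iv) at the genuine base -/

section WeakZFSM

variable {Z : LogDivisorModel.{u}} {G : Type u} [Group G] (A : Z.GaloisAction G) (hZ : Z.CuspLaws)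
  (hpf : ∀ Y : ((isConnectedGSet (G := G)).FullSubcategory)ᵒᵖ,
    IsPerfFactorialCof ((DivisorMonoids.ofGaloisActionConnected A hZ).Φ₀.obj Y))
  {D : Type u'} [Category.{v'} D] {IsRational IsStrictlyRational : (Dᵒᵖ ⥤ CommMonCat.{u}) → Prop}
  (C₁ : TemperedFrobenioid (RealifiedDivisorMonoids.ofRlfZWeak (DivisorMonoids.ofGaloisActionConnected A hZ) hpf) D
    (treeCatVocab D IsRational IsStrictlyRational))

/-- **Monoid type `ℤ`, weak data, ANY base of FSM-type: «`B` is a monoid on `D`»** — no binder (`hBinj` := p439044's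
`DivisorMonoids.ofGaloisActionConnected_ofRlfZWeak_hBinj`). [cite: MochizukiEtTh2009, Def 3.6 p.77] -/
theorem isMonoidOn_ratFnFunctor_ofRlfZWeak_ofGaloisActionConnected_of_isOfFSMType (hD : IsOfFSMType D) :
    IsMonoidOn C₁.ratFnFunctor :=
  C₁.isMonoidOn_ratFnFunctor_of_isOfFSMType (DivisorMonoids.ofGaloisActionConnected_ofRlfZWeak_hBinj A hZ hpf) hD

/-- **Monoid type `ℤ`, weak data, ANY base of FSM-type: «`C` IS a Frobenioid»** — no binder.
[cite: MochizukiEtTh2009, Def 3.6 p.77] -/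
theorem isFrobenioid_ofRlfZWeak_ofGaloisActionConnected_of_isOfFSMType (hD : IsOfFSMType D) :
    PreFrobenioid.IsFrobenioid C₁.toElem :=
  C₁.isFrobenioid_of_isOfFSMType (DivisorMonoids.ofGaloisActionConnected_ofRlfZWeak_hBinj A hZ hpf) hD

end WeakZFSM

section WeakZ

variable {Z : LogDivisorModel.{u}} {G : Type u} [Group G] (A : Z.GaloisAction G) (hZ : Z.CuspLaws)
  (hpf : ∀ Y : ((isConnectedGSet (G := G)).FullSubcategory)ᵒᵖ,
    IsPerfFactorialCof ((DivisorMonoids.ofGaloisActionConnected A hZ).Φ₀.obj Y))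
  {P : Type v} [Group P] [TopologicalSpace P]
  {IsRational IsStrictlyRational : ((ConnectedPart (BTemp P))ᵒᵖ ⥤ CommMonCat.{u}) → Prop}
  (C₁ : TemperedFrobenioid (RealifiedDivisorMonoids.ofRlfZWeak (DivisorMonoids.ofGaloisActionConnected A hZ) hpf)
    (ConnectedPart (BTemp P)) (treeCatVocab (ConnectedPart (BTemp P)) IsRational IsStrictlyRational))
  {p : ℕ} [Fact p.Prime]

/-- **Def 3.6 (ii) «`B` is a monoid on `D`» for EVERY tempered Frobenioid of monoid type `ℤ` over the weak constructed
data of the connected coverings at the genuine base `B^temp(Π)⁰` — UNCONDITIONAL.** [cite: MochizukiEtTh2009, Def 3.6 p.77] -/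
theorem isMonoidOn_ratFnFunctor_ofRlfZWeak_ofGaloisActionConnected_connectedPart_bTemp : IsMonoidOn C₁.ratFnFunctor :=
  C₁.isMonoidOn_ratFnFunctor_connectedPart_bTemp (DivisorMonoids.ofGaloisActionConnected_ofRlfZWeak_hBinj A hZ hpf)

/-- **«`C` is a Frobenioid» ([FrdI] Thm 5.2 (ii)) for EVERY tempered Frobenioid of monoid type `ℤ` over the weak
constructed data of the connected coverings at the genuine base — UNCONDITIONAL.** [cite: MochizukiEtTh2009, Def 3.6 p.77] -/
theorem isFrobenioid_ofRlfZWeak_ofGaloisActionConnected_connectedPart_bTemp : PreFrobenioid.IsFrobenioid C₁.toElem :=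
  C₁.isFrobenioid_connectedPart_bTemp (DivisorMonoids.ofGaloisActionConnected_ofRlfZWeak_hBinj A hZ hpf)

/-- **[EtTh] Thm 3.7 (i) «unit-profinite type» ∧ (iv) «`C` slim» for monoid type `ℤ` over the weak constructed data of
the connected coverings at the genuine base ⇐ {`Π` tempered, `Π` temp-slim, the Prop 3.4 (ii) isomorphisms
`Ker(B₀(Y_A)^× → (Φ₀^ℝ)^gp) ≅ O_L^×` (`hP34`)} ONLY** — no `hBinj`, no `hBmon`, no Rmk 3.7.2.
[cite: MochizukiEtTh2009, Thm 3.7 p.80] -/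
theorem isOfUnitProfiniteType_and_isSlim_ofRlfZWeak_ofGaloisActionConnected_connectedPart_bTemp [IsTopologicalGroup P]
    (hG : IsTempered P) (hS : IsSlimGroup P)
    (hP34 : ∀ B : (ConnectedPart (BTemp P))ᵒᵖ, ∃ L : PadicFrd.PadicFld.{uK} p, L.IsPadicLocal ∧
      Nonempty ((((RealifiedDivisorMonoids.ofRlfZWeak (DivisorMonoids.ofGaloisActionConnected A hZ) hpf).divΛ
        (C₁.baseOp B)).comp (Units.coeHom ((RealifiedDivisorMonoids.ofRlfZWeak
          (DivisorMonoids.ofGaloisActionConnected A hZ) hpf).BΛ.obj (C₁.baseOp B)))).ker ≃*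
        PadicFrd.unitSubgroup L.K)) :
    PreFrobenioid.IsOfUnitProfiniteType C₁.toElem ∧ IsSlim C₁.category :=
  have hF := isFrobenioid_ofRlfZWeak_ofGaloisActionConnected_connectedPart_bTemp A hZ hpf C₁
  ⟨C₁.isOfUnitProfiniteType_of_kerIsoPadicUnits hF hP34,
    C₁.isSlim_category_of_kerIsoPadicUnits hF hP34 (isSlim_connectedPart_bTemp hG hS)⟩

end WeakZ

section WeakZPrinted

variable {Z : LogDivisorModel.{u}} {G : Type u} [Group G] (A : Z.GaloisAction G) (hZ : Z.CuspLaws)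
  (hpf : ∀ Y : ((isConnectedGSet (G := G)).FullSubcategory)ᵒᵖ,
    IsPerfFactorialCof ((DivisorMonoids.ofGaloisActionConnected A hZ).Φ₀.obj Y))
  {K : Type v} [Field K] (X : TemperedArithmeticGroup.{v} K)
  {IsRational IsStrictlyRational : ((ConnectedPart (BTemp X.Pi))ᵒᵖ ⥤ CommMonCat.{u}) → Prop}
  (C₁ : TemperedFrobenioid (RealifiedDivisorMonoids.ofRlfZWeak (DivisorMonoids.ofGaloisActionConnected A hZ) hpf)
    (ConnectedPart (BTemp X.Pi)) (treeCatVocab (ConnectedPart (BTemp X.Pi)) IsRational IsStrictlyRational))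
  {p : ℕ} [Fact p.Prime]

/-- **[EtTh] Thm 3.7 (i) «unit-profinite type» ∧ (iv) «`C` slim» as printed, at `D = B^temp(Π^tp_X)⁰`, monoid type `ℤ`,
weak constructed data of the connected coverings ⇐ the Prop 3.4 (ii) isomorphisms `hP34` ALONE.**
[cite: MochizukiEtTh2009, Thm 3.7 p.80] -/
theorem isOfUnitProfiniteType_and_isSlim_ofRlfZWeak_ofGaloisActionConnected_of_temperedArithmeticGroup
    (hP34 : ∀ B : (ConnectedPart (BTemp X.Pi))ᵒᵖ, ∃ L : PadicFrd.PadicFld.{uK} p, L.IsPadicLocal ∧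
      Nonempty ((((RealifiedDivisorMonoids.ofRlfZWeak (DivisorMonoids.ofGaloisActionConnected A hZ) hpf).divΛ
        (C₁.baseOp B)).comp (Units.coeHom ((RealifiedDivisorMonoids.ofRlfZWeak
          (DivisorMonoids.ofGaloisActionConnected A hZ) hpf).BΛ.obj (C₁.baseOp B)))).ker ≃*
        PadicFrd.unitSubgroup L.K)) :
    PreFrobenioid.IsOfUnitProfiniteType C₁.toElem ∧ IsSlim C₁.category :=
  isOfUnitProfiniteType_and_isSlim_ofRlfZWeak_ofGaloisActionConnected_connectedPart_bTemp A hZ hpf C₁ X.isTempered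
    X.isSlimGroup hP34

end WeakZPrinted

/-! ### §4 The strong-data twins (`ofRlfR … hpf`, `ofRlfZ … hpf`: printed perf-factorial slot as the constructor parameter) -/

section StrongR

variable {Z : LogDivisorModel.{u}} {G : Type u} [Group G] (A : Z.GaloisAction G) (hZ : Z.CuspLaws)
  (hpf : ∀ Y : ((isConnectedGSet (G := G)).FullSubcategory)ᵒᵖ,
    IsPerfFactorial ((DivisorMonoids.ofGaloisActionConnected A hZ).Φ₀.obj Y))
  {P : Type v} [Group P] [TopologicalSpace P]
  {IsRational IsStrictlyRational : ((ConnectedPart (BTemp P))ᵒᵖ ⥤ CommMonCat.{u}) → Prop}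
  (C₀ : TemperedFrobenioid (RealifiedDivisorMonoids.ofRlfR (DivisorMonoids.ofGaloisActionConnected A hZ) hpf)
    (ConnectedPart (BTemp P)) (treeCatVocab (ConnectedPart (BTemp P)) IsRational IsStrictlyRational))

/-- **Def 3.6 (ii) «`B` is a monoid on `D`», monoid type `ℝ`, STRONG constructed data of the connected coverings, genuine
base** — no input beyond the constructor parameter `hpf`. [cite: MochizukiEtTh2009, Def 3.6 p.77] -/
theorem isMonoidOn_ratFnFunctor_ofRlfR_ofGaloisActionConnected_connectedPart_bTemp : IsMonoidOn C₀.ratFnFunctor :=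
  C₀.isMonoidOn_ratFnFunctor_connectedPart_bTemp (DivisorMonoids.ofGaloisActionConnected_ofRlfR_hBinj A hZ hpf)

/-- **«`C` is a Frobenioid», monoid type `ℝ`, STRONG constructed data of the connected coverings, genuine base** — no
input beyond `hpf`. [cite: MochizukiEtTh2009, Def 3.6 p.77] -/
theorem isFrobenioid_ofRlfR_ofGaloisActionConnected_connectedPart_bTemp : PreFrobenioid.IsFrobenioid C₀.toElem :=
  C₀.isFrobenioid_connectedPart_bTemp (DivisorMonoids.ofGaloisActionConnected_ofRlfR_hBinj A hZ hpf)

/-- **[EtTh] Thm 3.7 (iv) «`C` slim», monoid type `ℝ`, STRONG constructed data of the connected coverings, genuine base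
⇐ {`Π` tempered, `Π` temp-slim}** beyond `hpf` (abc-iut-w6-d048's `isSlim_category_ofRlfR_connectedPart_bTemp_of_reflects`
with both `Φ₀`-clauses discharged). [cite: MochizukiEtTh2009, Thm 3.7 p.80] -/
theorem isSlim_category_ofRlfR_ofGaloisActionConnected_connectedPart_bTemp [IsTopologicalGroup P] (hG : IsTempered P)
    (hS : IsSlimGroup P) : IsSlim C₀.category :=
  TemperedFrobenioid.isSlim_category_ofRlfR_connectedPart_bTemp_of_reflects _ hpf C₀ hG hS
    (fun g => DivisorMonoids.ofGaloisActionConnected_Φ₀_map_injective A hZ g)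
    (fun g a b h => DivisorMonoids.ofGaloisActionConnected_Φ₀_map_reflects_dvd A hZ g a b h)

end StrongR

section StrongZ

variable {Z : LogDivisorModel.{u}} {G : Type u} [Group G] (A : Z.GaloisAction G) (hZ : Z.CuspLaws)
  (hpf : ∀ Y : ((isConnectedGSet (G := G)).FullSubcategory)ᵒᵖ,
    IsPerfFactorial ((DivisorMonoids.ofGaloisActionConnected A hZ).Φ₀.obj Y))
  {P : Type v} [Group P] [TopologicalSpace P]
  {IsRational IsStrictlyRational : ((ConnectedPart (BTemp P))ᵒᵖ ⥤ CommMonCat.{u}) → Prop}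
  (C₁ : TemperedFrobenioid (RealifiedDivisorMonoids.ofRlfZ (DivisorMonoids.ofGaloisActionConnected A hZ) hpf)
    (ConnectedPart (BTemp P)) (treeCatVocab (ConnectedPart (BTemp P)) IsRational IsStrictlyRational))
  {p : ℕ} [Fact p.Prime]

/-- **Def 3.6 (ii) «`B` is a monoid on `D`», monoid type `ℤ`, STRONG constructed data, genuine base** — no input beyond
`hpf`. [cite: MochizukiEtTh2009, Def 3.6 p.77] -/
theorem isMonoidOn_ratFnFunctor_ofRlfZ_ofGaloisActionConnected_connectedPart_bTemp : IsMonoidOn C₁.ratFnFunctor :=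
  C₁.isMonoidOn_ratFnFunctor_connectedPart_bTemp (DivisorMonoids.ofGaloisActionConnected_ofRlfZ_hBinj A hZ hpf)

/-- **«`C` is a Frobenioid», monoid type `ℤ`, STRONG constructed data, genuine base** — no input beyond `hpf`.
[cite: MochizukiEtTh2009, Def 3.6 p.77] -/
theorem isFrobenioid_ofRlfZ_ofGaloisActionConnected_connectedPart_bTemp : PreFrobenioid.IsFrobenioid C₁.toElem :=
  C₁.isFrobenioid_connectedPart_bTemp (DivisorMonoids.ofGaloisActionConnected_ofRlfZ_hBinj A hZ hpf)

/-- **[EtTh] Thm 3.7 (i) «unit-profinite type» ∧ (iv) «`C` slim», monoid type `ℤ`, STRONG constructed data, genuine base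
⇐ {`Π` tempered, `Π` temp-slim, `hP34`}** beyond `hpf`. [cite: MochizukiEtTh2009, Thm 3.7 p.80] -/
theorem isOfUnitProfiniteType_and_isSlim_ofRlfZ_ofGaloisActionConnected_connectedPart_bTemp [IsTopologicalGroup P]
    (hG : IsTempered P) (hS : IsSlimGroup P)
    (hP34 : ∀ B : (ConnectedPart (BTemp P))ᵒᵖ, ∃ L : PadicFrd.PadicFld.{uK} p, L.IsPadicLocal ∧
      Nonempty ((((RealifiedDivisorMonoids.ofRlfZ (DivisorMonoids.ofGaloisActionConnected A hZ) hpf).divΛ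
        (C₁.baseOp B)).comp (Units.coeHom ((RealifiedDivisorMonoids.ofRlfZ
          (DivisorMonoids.ofGaloisActionConnected A hZ) hpf).BΛ.obj (C₁.baseOp B)))).ker ≃*
        PadicFrd.unitSubgroup L.K)) :
    PreFrobenioid.IsOfUnitProfiniteType C₁.toElem ∧ IsSlim C₁.category :=
  C₁.isOfUnitProfiniteType_and_isSlim_ofRlfZ_connectedPart_bTemp _ hpf hG hS
    (DivisorMonoids.ofGaloisActionConnected_ofRlfZ_hBinj A hZ hpf) hP34

end StrongZ

end TemperedFrobenioid

end Literature.AnabelianGeometry.EtaleTheta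

end
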